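import Summits.CriticalPhenomena.Ising3DConformalLimit.Theses.HyperoctahedralRP
import Summits.CriticalPhenomena.Ising3DConformalLimit.Theses.MonotoneRG
import Summits.CriticalPhenomena.Ising3DConformalLimit.Theorems.MoebiusLimitExists.Negative.FreeTranslations
import Summits.CriticalPhenomena.Ising3DConformalLimit.Theorems.MoebiusLimitExists.Negative.ScaleRedundant
import Summits.CriticalPhenomena.Ising3DConformalLimit.Theorems.MoebiusLimitExists.Negative.TwoPointPositivity
import Summits.CriticalPhenomena.Ising3DConformalLimit.Theorems.MoebiusLimitExists.Negative.OnlyInteractionTightness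
import HarnessLib

/-!
# `ExistsScaleCovariantLimit` (item stmt-CriticalPhenomena-1981) ⟺ TIGHTNESS ∧ UNIQUENESS of the
pinned zoom; the tightness half is `MonotoneRG.OrbitPrecompact` (item stmt-CriticalPhenomena-5955)

Negative / structural knowledge about the crux
`Summit.CriticalPhenomena.Ising3DConformalLimit.Theses.HyperoctahedralRP.ExistsScaleCovariantLimit`,
standing crux disprover, cycle 2 (D-0016); THEOREM-ONLY (the two halves are written out inline; the
cluster-point notion is the tree's `MoebiusLimitExistsOnlyInteraction.IsClusterPoint` of the pinned
zoom `ρ_pin(δ) = ⟨σ₀σ_{⌊1/δ⌋e₀}⟩^{-1/2}`).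

* `hasPointwiseScalingLimit_rhoPin'`, `pinnedLimit_of_crux`, `crux_of_pinnedLimit`: crux ⟺ the pinned
  zoom converges along the full filter (cf. `Negative/PinnedForm.lean`; reproved here to keep this
  file self-contained).
* `pinnedLimit_iff_tight_and_unique`: the pinned zoom converges (full filter, all `n`) ⟺
  (TIGHT) every mesh sequence in `(0,1]` tending to `0⁺` has a subsequence along which it converges
  locally uniformly off the diagonals for all `n`, AND (UNIQUE) any two cluster points agree off the
  diagonals. (`⇐`: a bad sequence extracted from a failure of uniform convergence on a compact,
  `exists_seq_forall_of_frequently`, has a convergent subsequence whose limit is THE cluster point.)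
* `tight_of_orbitPrecompact`, `orbitPrecompact_of_pinnedLimit`: TIGHT is implied by route
  `MonotoneRG`'s crux `OrbitPrecompact` (precompactness for SOME `ρ > 0` with non-degenerate cluster
  points: pin by the value at `(0,e₀)`), and the crux implies `OrbitPrecompact` with `ρ = ρ_pin`.
* `crux_iff_orbitPrecompact_and_unique`: **crux ⟺ `OrbitPrecompact` ∧ UNIQUE** — what any existence
  mechanism (monotone dynamics, zoom rigidity) must add to compactness is exactly uniqueness of the
  ω-limit point; discretely self-similar families are tight with two cluster points
  (`Literature/…/PointwiseScalingLimitDiscreteScaleInvariance.lean`, if landed).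

Reference: H. L. Smith, *Monotone Dynamical Systems* (AMS 1995), Thm 1.2.1 (convergence criterion) —
context only; the content here is elementary topology of locally uniform convergence. [folklore]
-/

noncomputable section

namespace Summit.CriticalPhenomena.Ising3DConformalLimit.ExistsScaleCovariantLimitNegative

open Literature.Probability.LatticeModels Filter Set
open scoped Topology
open Summit.CriticalPhenomena.Ising3DConformalLimit.Theses
open Summit.CriticalPhenomena.Ising3DConformalLimit.MoebiusLimitExistsNegative
open Summit.CriticalPhenomena.Ising3DConformalLimit.MoebiusLimitExistsOnlyInteraction (rhoPin IsClusterPoint)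
open Summit.CriticalPhenomena.Ising3DConformalLimit.PinnedClusterPoints
open Summit.CriticalPhenomena.Ising3DConformalLimit.OnlyInteractionTightness
  (limit_isBoundedUnder tendstoLocallyUniformlyOn_comp_tendsto abs_rescaledCorrelator_le)
open Classical

/-- The pinned zoom converges along the FULL filter under any non-degenerate witness (as in
`Negative/PinnedForm.lean`). [folklore] -/
theorem hasPointwiseScalingLimit_rhoPin' {ρ : ℝ → ℝ} {S' : CorrFamily 3}
    (hρ : ∀ δ ∈ Set.Ioc (0:ℝ) 1, 0 < ρ δ)
    (hlim : HasPointwiseScalingLimit (criticalCorr 3) ρ S') (hnd : IsNondegenerateTwoPoint S') :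
    HasPointwiseScalingLimit (criticalCorr 3) rhoPin
      (fun n x => ((S' 2 (![0, EuclideanSpace.single 0 1] : Fin 2 → EuclideanSpace ℝ (Fin 3))) ^
        (-(1 / 2 : ℝ))) ^ n * S' n x) := by
  intro n
  have hA : 0 < S' 2 (![0, EuclideanSpace.single 0 1] : Fin 2 → EuclideanSpace ℝ (Fin 3)) :=
    hnd _ cfg01_mem
  set r : ℝ → ℝ := fun δ => (rescaledCorrelator (criticalCorr 3) ρ 2 δ
    (![0, EuclideanSpace.single 0 1] : Fin 2 → EuclideanSpace ℝ (Fin 3))) ^ (-(1 / 2 : ℝ)) with hr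
  have hr_t : Tendsto (fun δ => r δ ^ n) (𝓝[>] (0:ℝ))
      (𝓝 (((S' 2 (![0, EuclideanSpace.single 0 1] : Fin 2 → EuclideanSpace ℝ (Fin 3))) ^
        (-(1 / 2 : ℝ))) ^ n)) :=
    ((((hlim 2).tendsto_at cfg01_mem).rpow_const (p := -(1 / 2 : ℝ)) (Or.inl hA.ne')).pow n)
  have hF1 : TendstoLocallyUniformlyOn (fun δ (_ : Fin n → EuclideanSpace ℝ (Fin 3)) => r δ ^ n)
      (fun _ => ((S' 2 (![0, EuclideanSpace.single 0 1] : Fin 2 → EuclideanSpace ℝ (Fin 3))) ^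
        (-(1 / 2 : ℝ))) ^ n) (𝓝[>] (0:ℝ)) (NonCoincident 3 n) :=
    (hr_t.tendstoUniformlyOn_const (NonCoincident 3 n)).tendstoLocallyUniformlyOn
  have hprod := hF1.mul₀_of_isBoundedUnder (hlim n)
    (fun x _ => isBoundedUnder_of ⟨dist (((S' 2 (![0, EuclideanSpace.single 0 1] : Fin 2 →
      EuclideanSpace ℝ (Fin 3))) ^ (-(1 / 2 : ℝ))) ^ n) 0, fun _ => le_rfl⟩)
    (fun x hx => limit_isBoundedUnder hlim n hx)
  refine hprod.congr_inseparable ?_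
  filter_upwards [Ioc_mem_nhdsGT one_pos] with δ hδ x _
  exact Inseparable.of_eq (rescaled_pin_eq (hρ δ hδ) n x).symm

/-- crux ⟹ the pinned zoom converges. [folklore] -/
theorem pinnedLimit_of_crux (h : HyperoctahedralRP.ExistsScaleCovariantLimit) :
    ∃ S : CorrFamily 3, HasPointwiseScalingLimit (criticalCorr 3) rhoPin S := by
  obtain ⟨ρ, Δ, S', hρ, -, hlim, -, hnd, -, -⟩ := h
  exact ⟨_, hasPointwiseScalingLimit_rhoPin' hρ hlim hnd⟩

/-- `ρ_pin > 0`. [folklore] -/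
theorem rhoPin_pos' (δ : ℝ) : 0 < rhoPin δ :=
  Real.rpow_pos_of_pos (criticalTwoPoint_pos3 _) _

/-- The pinned zoom converges ⟹ crux (non-degeneracy from `S₂(0,e₀) = 1`; the other clauses are
free). [folklore] -/
theorem crux_of_pinnedLimit {S : CorrFamily 3}
    (hlim : HasPointwiseScalingLimit (criticalCorr 3) rhoPin S) :
    HyperoctahedralRP.ExistsScaleCovariantLimit := by
  have h1 : S 2 (![0, EuclideanSpace.single 0 1] : Fin 2 → EuclideanSpace ℝ (Fin 3)) = 1 := by
    have h := (hlim 2).tendsto_at cfg01_mem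
    simp_rw [rescaled_pin_cfg01] at h
    exact (tendsto_nhds_unique tendsto_const_nhds h).symm
  have hnd : IsNondegenerateTwoPoint S :=
    (isNondegenerateTwoPoint_iff_exists_pos hlim).2 ⟨_, cfg01_mem, by rw [h1]; exact one_pos⟩
  have hρ : ∀ δ ∈ Set.Ioc (0:ℝ) 1, 0 < rhoPin δ := fun δ _ => rhoPin_pos' δ
  obtain ⟨Δ, hwin, hsc⟩ := exists_scaleCovariant_normalised hρ hlim hnd
  exact ⟨rhoPin, Δ, fun n x => if x ∈ NonCoincident 3 n then S n x else 0, hρ, by linarith [hwin.1],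
    normalised_hasLimit hlim, fun n z hz => if_neg hz, normalised_nondeg hnd,
    isTranslationInvariant_normalised_of_limit hlim, hsc⟩

/-- The meshes `1/(k+1)` lie in `(0,1]`. [folklore] -/
theorem one_div_succ_mem_Ioc (k : ℕ) : 1 / ((k:ℝ) + 1) ∈ Set.Ioc (0:ℝ) 1 := by
  constructor
  · positivity
  · rw [div_le_one (by positivity)]; linarith [k.cast_nonneg (α := ℝ)]

/-- **The pinned zoom converges ⟺ it is TIGHT and has a UNIQUE cluster point.** [folklore] -/
theorem pinnedLimit_iff_tight_and_unique :
    (∃ S : CorrFamily 3, HasPointwiseScalingLimit (criticalCorr 3) rhoPin S) ↔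
      (∀ u : ℕ → ℝ, (∀ k, u k ∈ Set.Ioc (0:ℝ) 1) → Tendsto u atTop (𝓝[>] (0:ℝ)) →
        ∃ φ : ℕ → ℕ, StrictMono φ ∧ ∃ S : CorrFamily 3, ∀ n,
          TendstoLocallyUniformlyOn (fun k => rescaledCorrelator (criticalCorr 3) rhoPin n (u (φ k)))
            (S n) atTop (NonCoincident 3 n)) ∧
      (∀ S S' : CorrFamily 3, IsClusterPoint S → IsClusterPoint S' →
        ∀ n, Set.EqOn (S n) (S' n) (NonCoincident 3 n)) := by
  constructor
  · rintro ⟨S, hlim⟩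
    refine ⟨fun u _ hu => ⟨id, strictMono_id, S, fun n => tendstoLocallyUniformlyOn_comp_tendsto (hlim n) hu⟩,
      fun S₁ S₂ h₁ h₂ n x hx => ?_⟩
    obtain ⟨u₁, hu₁, hc₁⟩ := h₁
    obtain ⟨u₂, hu₂, hc₂⟩ := h₂
    have e₁ : S₁ n x = S n x :=
      tendsto_nhds_unique ((hc₁ n).tendsto_at hx) (((hlim n).tendsto_at hx).comp hu₁)
    have e₂ : S₂ n x = S n x :=
      tendsto_nhds_unique ((hc₂ n).tendsto_at hx) (((hlim n).tendsto_at hx).comp hu₂)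
    rw [e₁, e₂]
  · rintro ⟨hpc, huq⟩
    obtain ⟨φ₀, hφ₀, S₀, h₀⟩ := hpc _ one_div_succ_mem_Ioc (tendsto_div_succ_nhdsGT one_pos)
    have hS₀ : IsClusterPoint S₀ :=
      ⟨fun k => 1 / (((φ₀ k : ℕ) : ℝ) + 1), (tendsto_div_succ_nhdsGT one_pos).comp hφ₀.tendsto_atTop, h₀⟩
    refine ⟨S₀, fun n => ?_⟩
    rw [tendstoLocallyUniformlyOn_iff_forall_isCompact (isOpen_nonCoincident 3 n)]
    intro K hK hKc
    rw [Metric.tendstoUniformlyOn_iff]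
    intro ε hε
    by_contra hnot
    have hfreq : ∃ᶠ δ in 𝓝[>] (0:ℝ), δ ∈ Set.Ioc (0:ℝ) 1 ∧
        ¬ ∀ x ∈ K, dist (S₀ n x) (rescaledCorrelator (criticalCorr 3) rhoPin n δ x) < ε :=
      ((Filter.not_eventually.1 hnot).and_eventually (Ioc_mem_nhdsGT one_pos)).mono
        fun δ h => ⟨h.2, h.1⟩
    obtain ⟨v, hv, hbad⟩ := exists_seq_forall_of_frequently hfreq
    obtain ⟨φ, hφ, S, hS⟩ := hpc v (fun k => (hbad k).1) hv
    have hSc : IsClusterPoint S := ⟨v ∘ φ, hv.comp hφ.tendsto_atTop, hS⟩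
    have hS' : TendstoLocallyUniformlyOn
        (fun k => rescaledCorrelator (criticalCorr 3) rhoPin n (v (φ k))) (S₀ n) atTop
        (NonCoincident 3 n) := (hS n).congr_right (huq S S₀ hSc hS₀ n)
    have hU := (tendstoLocallyUniformlyOn_iff_forall_isCompact (isOpen_nonCoincident 3 n)).1 hS' K hK hKc
    obtain ⟨k, hk⟩ := (Metric.tendstoUniformlyOn_iff.1 hU ε hε).exists
    exact (hbad (φ k)).2 hk

/-- A sequential locally uniform limit of rescaled correlators is locally bounded. [folklore] -/
theorem seqLimit_isBoundedUnder {ρ : ℝ → ℝ} {S : CorrFamily 3} {u : ℕ → ℝ} (n : ℕ)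
    (h : TendstoLocallyUniformlyOn (fun k => rescaledCorrelator (criticalCorr 3) ρ n (u k)) (S n)
      atTop (NonCoincident 3 n))
    {x : Fin n → EuclideanSpace ℝ (Fin 3)} (hx : x ∈ NonCoincident 3 n) :
    (𝓝[NonCoincident 3 n] x).IsBoundedUnder (· ≤ ·) (fun y => dist (S n y) 0) := by
  obtain ⟨t, ht, hev⟩ := (Metric.tendstoLocallyUniformlyOn_iff.1 h) 1 one_pos x hx
  obtain ⟨k, hk⟩ := hev.exists
  refine isBoundedUnder_of_eventually_le (a := |ρ (u k)| ^ n + 1) ?_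
  filter_upwards [ht] with y hy
  have h1 := hk y hy
  rw [Real.dist_eq] at h1
  rw [Real.dist_eq, sub_zero]
  have h2 := abs_rescaledCorrelator_le ρ n (u k) y
  have h3 := abs_sub_abs_le_abs_sub (S n y) (rescaledCorrelator (criticalCorr 3) ρ n (u k) y)
  linarith

/-- **`OrbitPrecompact` ⟹ TIGHTNESS of the pinned zoom** (pin each subsequential limit by its value
at `(0,e₀)`). [folklore] -/
theorem tight_of_orbitPrecompact (h : MonotoneRG.OrbitPrecompact) :
    ∀ u : ℕ → ℝ, (∀ k, u k ∈ Set.Ioc (0:ℝ) 1) → Tendsto u atTop (𝓝[>] (0:ℝ)) →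
      ∃ φ : ℕ → ℕ, StrictMono φ ∧ ∃ S : CorrFamily 3, ∀ n,
        TendstoLocallyUniformlyOn (fun k => rescaledCorrelator (criticalCorr 3) rhoPin n (u (φ k)))
          (S n) atTop (NonCoincident 3 n) := by
  obtain ⟨ρ, hρ, h⟩ := h
  intro u hu1 hu
  have hu0 : Tendsto u atTop (𝓝 0) := (tendsto_nhdsWithin_iff.1 hu).1
  obtain ⟨φ, S, hφ, hnd, hconv⟩ := h u hu1 hu0
  set cfg : Fin 2 → EuclideanSpace ℝ (Fin 3) := ![0, EuclideanSpace.single 0 1] with hcfg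
  have hA : 0 < S 2 cfg := hnd _ cfg01_mem
  refine ⟨φ, hφ, fun n x => ((S 2 cfg) ^ (-(1 / 2 : ℝ))) ^ n * S n x, fun n => ?_⟩
  set r : ℕ → ℝ := fun k => (rescaledCorrelator (criticalCorr 3) ρ 2 (u (φ k)) cfg) ^ (-(1 / 2 : ℝ))
    with hr
  have hr_t : Tendsto (fun k => r k ^ n) atTop (𝓝 (((S 2 cfg) ^ (-(1 / 2 : ℝ))) ^ n)) :=
    ((((hconv 2).tendsto_at cfg01_mem).rpow_const (p := -(1 / 2 : ℝ)) (Or.inl hA.ne')).pow n)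
  have hF1 : TendstoLocallyUniformlyOn (fun k (_ : Fin n → EuclideanSpace ℝ (Fin 3)) => r k ^ n)
      (fun _ => ((S 2 cfg) ^ (-(1 / 2 : ℝ))) ^ n) atTop (NonCoincident 3 n) :=
    (hr_t.tendstoUniformlyOn_const (NonCoincident 3 n)).tendstoLocallyUniformlyOn
  have hprod := hF1.mul₀_of_isBoundedUnder (hconv n)
    (fun x _ => isBoundedUnder_of ⟨dist (((S 2 cfg) ^ (-(1 / 2 : ℝ))) ^ n) 0, fun _ => le_rfl⟩)
    (fun x hx => seqLimit_isBoundedUnder n (hconv n) hx)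
  refine hprod.congr fun k y _ => ?_
  exact (rescaled_pin_eq (hρ _ (hu1 (φ k))) n y).symm

/-- The pinned limit gives `OrbitPrecompact` with `ρ = ρ_pin`. [folklore] -/
theorem orbitPrecompact_of_pinnedLimit {S : CorrFamily 3}
    (hlim : HasPointwiseScalingLimit (criticalCorr 3) rhoPin S) : MonotoneRG.OrbitPrecompact := by
  have hρ : ∀ δ ∈ Set.Ioc (0:ℝ) 1, 0 < rhoPin δ := fun δ _ => rhoPin_pos' δ
  have h1 : S 2 (![0, EuclideanSpace.single 0 1] : Fin 2 → EuclideanSpace ℝ (Fin 3)) = 1 := by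
    have h := (hlim 2).tendsto_at cfg01_mem
    simp_rw [rescaled_pin_cfg01] at h
    exact (tendsto_nhds_unique tendsto_const_nhds h).symm
  have hnd : IsNondegenerateTwoPoint S :=
    (isNondegenerateTwoPoint_iff_exists_pos hlim).2 ⟨_, cfg01_mem, by rw [h1]; exact one_pos⟩
  refine ⟨rhoPin, hρ, fun u hu1 hu0 => ⟨id, S, strictMono_id, hnd, fun n => ?_⟩⟩
  have hu : Tendsto u atTop (𝓝[>] (0:ℝ)) :=
    tendsto_nhdsWithin_iff.2 ⟨hu0, Filter.Eventually.of_forall fun k => (hu1 k).1⟩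
  exact tendstoLocallyUniformlyOn_comp_tendsto (hlim n) hu

/-- **crux ⟺ `OrbitPrecompact` (route `MonotoneRG`, item 5955) ∧ uniqueness of the pinned cluster
point.** [folklore] -/
theorem crux_iff_orbitPrecompact_and_unique :
    HyperoctahedralRP.ExistsScaleCovariantLimit ↔
      MonotoneRG.OrbitPrecompact ∧
        ∀ S S' : CorrFamily 3, IsClusterPoint S → IsClusterPoint S' →
          ∀ n, Set.EqOn (S n) (S' n) (NonCoincident 3 n) := by
  constructor
  · intro h
    obtain ⟨S, hlim⟩ := pinnedLimit_of_crux h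
    exact ⟨orbitPrecompact_of_pinnedLimit hlim, (pinnedLimit_iff_tight_and_unique.1 ⟨S, hlim⟩).2⟩
  · rintro ⟨hpc, huq⟩
    obtain ⟨S, hlim⟩ := pinnedLimit_iff_tight_and_unique.2 ⟨tight_of_orbitPrecompact hpc, huq⟩
    exact crux_of_pinnedLimit hlim

/-- The same with `MonotoneRG`'s own copy of the shared decl (definitionally the same item 1981).
[folklore] -/
theorem monotoneRG_target_iff_orbitPrecompact_and_unique :
    MonotoneRG.ExistsScaleCovariantLimit ↔
      MonotoneRG.OrbitPrecompact ∧
        ∀ S S' : CorrFamily 3, IsClusterPoint S → IsClusterPoint S' →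
          ∀ n, Set.EqOn (S n) (S' n) (NonCoincident 3 n) :=
  crux_iff_orbitPrecompact_and_unique

end Summit.CriticalPhenomena.Ising3DConformalLimit.ExistsScaleCovariantLimitNegative

end
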